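import Mathlib
import HarnessLib

/-!
# Item `LrcModEntire` (stmt-NavierStokesRegularity-20428) — (Q3∞) input (U-LL): UNIFORM LATERAL LEVEL along a uniformly non-degenerate hot branch

ns-k2-port-2 g5 (helper prover under the LEAD of item 20428, ns-poloidal-K2-p3 g14; `--supports stmt-NavierStokesRegularity-20428 --as helper`).
The one input of `…LrcModEntireRidgeHullValues.exists_hullLimit_crossSectionMax_const` that the LEAD's (LL) `…LateralLevel.lateralLevel_persist` gives only PER COMPACT ARC
(by continuity + compactness) is the lateral level `m` and the window `δ` UNIFORMLY along the whole branch.  Class-free and quantitative: write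
`W τ s n z := σv₂(−1+τ, γ(s) + nν(s) + z e₂)` and `M := σN`.  If at every hot point the critical second-order expansion holds with UNIFORM constants
(`|W 0 s n z − (M − ½κ(s)n² + α(s)nz + ½β(s)z²)| ≤ C₃(|n|+|z|)³`, `κ ≥ κ₀ > 0`, `|α|,|β| ≤ A` — the LEAD's (H) `…RidgeTaylor` with the KNSS slice bounds) and `W` is
time-Lipschitz near `τ = 0` uniformly (`|W τ s n z − W 0 s n z| ≤ C_t|τ|` for `|τ| ≤ δ₀` — a Type-I class bound), then for a thin tube `32·C₃·r ≤ κ₀` and every window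
`δ ≤ min(δ₀, r)` with `8(2Ar + C_t + κ₀r + 1)δ ≤ κ₀r²`, the CONSTANT level `m = M − κ₀r²/8` separates: lateral values `W τ s (±r) z < m ≤ W τ s 0 z` (centre) for all `s` and all
`|τ|, |z| < δ`.

* `lateral_lt_level`, `level_le_centre` — the two inequalities for a given admissible `δ`;
* `exists_uniform_lateralLevel` — ∃ such a `δ ∈ (0, 1/2]` (explicit `min`), packaged in the `hlat`/`hmid` shape of `exists_hullLimit_crossSectionMax_const`.

WHAT THIS IS NOT: not a claim about Navier–Stokes regularity — elementary inequalities feeding the (Q3∞) hull homogenisation on hypothetical profiles (bears_on LADDER-NS N0, item 20428 /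
crux 19708; 20428/19708/27893 OPEN).  No summit statement is proved here.
-/

noncomputable section

-- the summit and its single sub-problem share the name (CONVENTIONS §1), as in every Theorems file
set_option linter.dupNamespace false

namespace Summit.NavierStokesRegularity.NavierStokesRegularity.Theorems.PoloidalWindowDoorLrcModEntireRidgeUniformLateral

open Set

variable {W : ℝ → ℝ → ℝ → ℝ → ℝ} {M κ₀ A C₃ Ct δ₀ r δ : ℝ} {κ α β : ℝ → ℝ}

/-- The cubic remainder on the thin tube: `|z| ≤ r`, `32 C₃ r ≤ κ₀` ⇒ `C₃ (r + |z|)³ ≤ κ₀ r²/4`. -/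
theorem cubic_le (hC₃ : 0 ≤ C₃) (hr : 0 < r) (hthin : 32 * C₃ * r ≤ κ₀) {z : ℝ} (hz : |z| ≤ r) :
    C₃ * (r + |z|) ^ 3 ≤ κ₀ * r ^ 2 / 4 := by
  have h1 : (r + |z|) ^ 3 ≤ (2 * r) ^ 3 := by
    apply pow_le_pow_left₀ (by positivity) (by linarith)
  have h2 : C₃ * (r + |z|) ^ 3 ≤ C₃ * (2 * r) ^ 3 := mul_le_mul_of_nonneg_left h1 hC₃
  have h3 : C₃ * (2 * r) ^ 3 = 8 * (C₃ * r) * r ^ 2 := by ring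
  have h4 : 8 * (C₃ * r) * r ^ 2 ≤ 8 * (κ₀ / 32) * r ^ 2 := by
    have : C₃ * r ≤ κ₀ / 32 := by linarith
    exact mul_le_mul_of_nonneg_right (mul_le_mul_of_nonneg_left this (by norm_num)) (by positivity)
  linarith

/-- **Lateral values lie strictly below the level `M − κ₀r²/8`**, uniformly along the branch. -/
theorem lateral_lt_level
    (hexp : ∀ s n z : ℝ, |W 0 s n z - (M - κ s / 2 * n ^ 2 + α s * n * z + β s / 2 * z ^ 2)| ≤ C₃ * (|n| + |z|) ^ 3)
    (hκ : ∀ s, κ₀ ≤ κ s) (hα : ∀ s, |α s| ≤ A) (hβ : ∀ s, |β s| ≤ A) (hκ₀ : 0 < κ₀) (hA : 0 ≤ A) (hC₃ : 0 ≤ C₃)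
    (htime : ∀ τ s n z : ℝ, |τ| ≤ δ₀ → |W τ s n z - W 0 s n z| ≤ Ct * |τ|) (hCt : 0 ≤ Ct)
    (hr : 0 < r) (hthin : 32 * C₃ * r ≤ κ₀)
    (hδ0 : δ ≤ δ₀) (hδr : δ ≤ r) (hδs : 8 * (2 * A * r + Ct + κ₀ * r + 1) * δ ≤ κ₀ * r ^ 2)
    {τ z : ℝ} (hτ : |τ| < δ) (hz : |z| < δ) (s n : ℝ) (hn : n = r ∨ n = -r) :
    W τ s n z < M - κ₀ * r ^ 2 / 8 := by
  have hδpos : 0 < δ := lt_of_le_of_lt (abs_nonneg τ) hτ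
  have hnabs : |n| = r := by rcases hn with rfl | rfl <;> simp [abs_of_pos hr]
  have hn2 : n ^ 2 = r ^ 2 := by rcases hn with rfl | rfl <;> ring
  have hzr : |z| ≤ r := hz.le.trans hδr
  -- the expansion at `τ = 0`
  have h0 := hexp s n z
  rw [hnabs] at h0
  have hcub := cubic_le (κ₀ := κ₀) hC₃ hr hthin hzr
  have hup : W 0 s n z ≤ M - κ s / 2 * n ^ 2 + α s * n * z + β s / 2 * z ^ 2 + κ₀ * r ^ 2 / 4 := by
    linarith [(abs_le.1 h0).2]
  -- the quadratic model on the lateral boundary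
  have hκs : κ₀ * r ^ 2 / 2 ≤ κ s / 2 * n ^ 2 := by rw [hn2]; nlinarith [hκ s, sq_nonneg r]
  have hαz : α s * n * z ≤ A * r * δ := by
    have h1 : α s * n * z ≤ |α s * n * z| := le_abs_self _
    rw [abs_mul, abs_mul, hnabs] at h1
    have h2 : |α s| * r * |z| ≤ A * r * δ := by
      have := hα s
      have h3 : |α s| * r ≤ A * r := mul_le_mul_of_nonneg_right this hr.le
      exact mul_le_mul h3 hz.le (abs_nonneg z) (by positivity)
    linarith
  have hβz : β s / 2 * z ^ 2 ≤ A / 2 * (r * δ) := by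
    have h1 : β s / 2 * z ^ 2 ≤ |β s| / 2 * z ^ 2 := by
      have : β s ≤ |β s| := le_abs_self _
      nlinarith [sq_nonneg z]
    have h2 : z ^ 2 ≤ r * δ := by
      have hz2 : z ^ 2 = |z| ^ 2 := (sq_abs z).symm
      rw [hz2]; nlinarith [abs_nonneg z, hz.le, hzr]
    have h3 : |β s| / 2 * z ^ 2 ≤ A / 2 * (r * δ) := by
      exact mul_le_mul (by linarith [hβ s]) h2 (sq_nonneg z) (by positivity)
    linarith
  -- the time shift
  have ht := htime τ s n z (hτ.le.trans hδ0)
  have hT : W τ s n z ≤ W 0 s n z + Ct * δ := by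
    have := (abs_le.1 ht).2
    nlinarith [abs_nonneg τ, hτ.le]
  -- bookkeeping: `(A r + A r/2 + Ct) δ < κ₀ r²/8`
  have hslack : (2 * A * r + Ct) * δ < κ₀ * r ^ 2 / 8 := by
    have hkrd : 0 < κ₀ * r * δ := by positivity
    have h1 : (2 * A * r + Ct) * δ ≤ (2 * A * r + Ct + κ₀ * r + 1) * δ - δ := by nlinarith [hkrd]
    have h2 : (2 * A * r + Ct + κ₀ * r + 1) * δ ≤ κ₀ * r ^ 2 / 8 := by linarith
    linarith
  have hArδ : 0 ≤ A * r * δ := by positivity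
  nlinarith [hup, hκs, hαz, hβz, hT, hslack, hArδ]

/-- **The centre value dominates the level `M − κ₀r²/8`**, uniformly along the branch. -/
theorem level_le_centre
    (hexp : ∀ s n z : ℝ, |W 0 s n z - (M - κ s / 2 * n ^ 2 + α s * n * z + β s / 2 * z ^ 2)| ≤ C₃ * (|n| + |z|) ^ 3)
    (hβ : ∀ s, |β s| ≤ A) (hκ₀ : 0 < κ₀) (hA : 0 ≤ A)
    (htime : ∀ τ s n z : ℝ, |τ| ≤ δ₀ → |W τ s n z - W 0 s n z| ≤ Ct * |τ|) (hCt : 0 ≤ Ct)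
    (hr : 0 < r) (hthin : 32 * C₃ * r ≤ κ₀)
    (hδ0 : δ ≤ δ₀) (hδr : δ ≤ r) (hδs : 8 * (2 * A * r + Ct + κ₀ * r + 1) * δ ≤ κ₀ * r ^ 2)
    {τ z : ℝ} (hτ : |τ| < δ) (hz : |z| < δ) (s : ℝ) :
    M - κ₀ * r ^ 2 / 8 ≤ W τ s 0 z := by
  have hδpos : 0 < δ := lt_of_le_of_lt (abs_nonneg τ) hτ
  have hzr : |z| ≤ r := hz.le.trans hδr
  have h0 := hexp s 0 z
  simp only [abs_zero, zero_add, ne_eq, OfNat.ofNat_ne_zero, not_false_eq_true, zero_pow, mul_zero, sub_zero, mul_zero, zero_mul, add_zero] at h0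
  -- `W 0 s 0 z ≥ M + β/2 z² − C₃|z|³`
  have hlow : M + β s / 2 * z ^ 2 - C₃ * |z| ^ 3 ≤ W 0 s 0 z := by linarith [(abs_le.1 h0).1]
  have hβz : -(A / 2 * (r * δ)) ≤ β s / 2 * z ^ 2 := by
    have h1 : -(|β s| / 2 * z ^ 2) ≤ β s / 2 * z ^ 2 := by
      have : -|β s| ≤ β s := neg_abs_le _
      nlinarith [sq_nonneg z]
    have h2 : z ^ 2 ≤ r * δ := by
      have hz2 : z ^ 2 = |z| ^ 2 := (sq_abs z).symm
      rw [hz2]; nlinarith [abs_nonneg z, hz.le, hzr]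
    have h3 : |β s| / 2 * z ^ 2 ≤ A / 2 * (r * δ) :=
      mul_le_mul (by linarith [hβ s]) h2 (sq_nonneg z) (by positivity)
    linarith
  have hcub : C₃ * |z| ^ 3 ≤ κ₀ * r / 32 * δ := by
    have h1 : |z| ^ 3 ≤ r * r * δ := by
      have : |z| ^ 3 = |z| * |z| * |z| := by ring
      rw [this]
      have ha := abs_nonneg z
      calc |z| * |z| * |z| ≤ r * r * |z| := by
            exact mul_le_mul (mul_le_mul hzr hzr ha hr.le) le_rfl ha (by positivity)
        _ ≤ r * r * δ := mul_le_mul_of_nonneg_left hz.le (by positivity)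
    have h2 : C₃ ≤ κ₀ / 32 / r := by rw [le_div_iff₀ hr]; linarith
    calc C₃ * |z| ^ 3 ≤ κ₀ / 32 / r * (r * r * δ) := mul_le_mul h2 h1 (by positivity) (by positivity)
      _ = κ₀ * r / 32 * δ := by field_simp
  have ht := htime τ s 0 z (hτ.le.trans hδ0)
  have hT : W 0 s 0 z - Ct * δ ≤ W τ s 0 z := by
    have := (abs_le.1 ht).1
    nlinarith [abs_nonneg τ, hτ.le]
  have hslack : (A / 2 * r + κ₀ * r / 32 + Ct) * δ ≤ κ₀ * r ^ 2 / 8 := by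
    have hAr : 0 ≤ A * r := mul_nonneg hA hr.le
    have hkr : 0 ≤ κ₀ * r := (mul_pos hκ₀ hr).le
    have h1 : (A / 2 * r + κ₀ * r / 32 + Ct) * δ ≤ (2 * A * r + Ct + κ₀ * r + 1) * δ := by
      apply mul_le_mul_of_nonneg_right _ hδpos.le
      linarith
    linarith
  nlinarith [hlow, hβz, hcub, hT, hslack]

/-- **(U-LL) UNIFORM LATERAL LEVEL — existence of the window.**  Under the uniform expansion and time-Lipschitz hypotheses and the thin tube `32 C₃ r ≤ κ₀`, there is
`δ ∈ (0, 1/2]`, `δ ≤ δ₀`, such that with the constant level `m = M − κ₀r²/8`: lateral `W τ s (±r) z < m` and centre `m ≤ W τ s 0 z` for all `s` and all `|τ|, |z| < δ` — the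
`hlat`/`hmid` inputs of `…LrcModEntireRidgeHullValues.exists_hullLimit_crossSectionMax_const` with `W τ s n z := σv₂(−1+τ, γ s + nν s + z e₂)`. -/
theorem exists_uniform_lateralLevel
    (hexp : ∀ s n z : ℝ, |W 0 s n z - (M - κ s / 2 * n ^ 2 + α s * n * z + β s / 2 * z ^ 2)| ≤ C₃ * (|n| + |z|) ^ 3)
    (hκ : ∀ s, κ₀ ≤ κ s) (hα : ∀ s, |α s| ≤ A) (hβ : ∀ s, |β s| ≤ A) (hκ₀ : 0 < κ₀) (hA : 0 ≤ A) (hC₃ : 0 ≤ C₃)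
    (htime : ∀ τ s n z : ℝ, |τ| ≤ δ₀ → |W τ s n z - W 0 s n z| ≤ Ct * |τ|) (hCt : 0 ≤ Ct) (hδ₀ : 0 < δ₀)
    (hr : 0 < r) (hthin : 32 * C₃ * r ≤ κ₀) :
    ∃ δ : ℝ, 0 < δ ∧ δ ≤ 1 / 2 ∧ δ ≤ δ₀ ∧
      (∀ τ z : ℝ, |τ| < δ → |z| < δ → ∀ s n : ℝ, (n = r ∨ n = -r) → W τ s n z < M - κ₀ * r ^ 2 / 8) ∧
      (∀ τ z : ℝ, |τ| < δ → |z| < δ → ∀ s : ℝ, M - κ₀ * r ^ 2 / 8 ≤ W τ s 0 z) := by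
  set D : ℝ := 2 * A * r + Ct + κ₀ * r + 1 with hD
  have hDpos : 0 < D := by rw [hD]; nlinarith [mul_pos hκ₀ hr, hA, hr]
  set δ : ℝ := min (min δ₀ (1 / 2)) (min r (κ₀ * r ^ 2 / (8 * D))) with hδ
  have hδpos : 0 < δ := by
    rw [hδ]; refine lt_min (lt_min hδ₀ (by norm_num)) (lt_min hr (by positivity))
  have hδ0 : δ ≤ δ₀ := (min_le_left _ _).trans (min_le_left _ _)
  have hδhalf : δ ≤ 1 / 2 := (min_le_left _ _).trans (min_le_right _ _)
  have hδr : δ ≤ r := (min_le_right _ _).trans (min_le_left _ _)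
  have hδs : 8 * (2 * A * r + Ct + κ₀ * r + 1) * δ ≤ κ₀ * r ^ 2 := by
    have h1 : δ ≤ κ₀ * r ^ 2 / (8 * D) := (min_le_right _ _).trans (min_le_right _ _)
    rw [← hD]
    have h2 := mul_le_mul_of_nonneg_left h1 (by positivity : (0 : ℝ) ≤ 8 * D)
    have h3 : 8 * D * (κ₀ * r ^ 2 / (8 * D)) = κ₀ * r ^ 2 := by field_simp
    linarith
  exact ⟨δ, hδpos, hδhalf, hδ0,
    fun τ z hτ hz s n hn => lateral_lt_level hexp hκ hα hβ hκ₀ hA hC₃ htime hCt hr hthin hδ0 hδr hδs hτ hz s n hn,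
    fun τ z hτ hz s => level_le_centre hexp hβ hκ₀ hA htime hCt hr hthin hδ0 hδr hδs hτ hz s⟩

end Summit.NavierStokesRegularity.NavierStokesRegularity.Theorems.PoloidalWindowDoorLrcModEntireRidgeUniformLateral

end
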